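import Literature.MathematicalPhysics.QuantumFieldTheory.Balaban1983to89.T4GenFunConverse
import Literature.MathematicalPhysics.QuantumFieldTheory.Balaban1983to89.T4WeightBudget

/-!
# BalabanUVNodes ∕ N27 spine-record join, IV — the E1∕E2 dictionary at the datum is NON-DEGENERATE: positive class totals,
# nonempty classes (an A2-type vacuity audit answered in kernel; companion of `BalabanUVNodesN27SpineRecordJoin` p411789,
# cell `pub-ymgap`, HUMAN RULING D-0062 Track A, seat `pub-ymgap-dag-n27-a` g2; `--supports stmt-QuantumFields-19182`, count-neutral)

WHY.  Referee ref-B's vacuity note A2 on the N19 knit (INBOX l.9244): «`T K = ∅` satisfies every term-wise binder and `Core` — the record's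
shape, tied to the runs' class sums only at the E1∕E2 dictionary».  At N27's level the dictionary IS a hypothesis (`hK5` of
`hybridNE7Under_of_spineRecordAtDatum[_sync]`: run A's ∕ run B's class sums ARE the GENUINE dressed partition functions
`T4GenFunBounds.schemeZ (D.scheme g₀) os (K₀ + K)` ∕ `(K₀ + K + 1)` on `|t| ≤ l₀`), and those are POSITIVE at the datum (ferromagnetic Wilson
weight `β_K = (g₀ K)⁻² ≥ 0`, averaged loop variables measurable — the NAMED hypothesis `D.AvgMeasurable`, discharged under binder B1 by
`IsPrintedAveraged.avgMeasurable` — and bounded by `1`; `T4GenFunBounds.dressedZ_pos`).  Hence every class total is positive and every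
term class nonempty: the N27 join's antecedent is NOT met by an empty or weightless class expansion.  (What it does not exclude — and
should not — is the SINGLETON expansion of dag-n23-b's `T4MatchingDegenerate`, under which B5 ⇔ `MatchingUnder`: then all content sits in
`core`, i.e. in the N19 knits' hypotheses.)  [folklore] throughout; 0 `def`, 0 `sorry`.

HONEST FRAMING.  Bookkeeping about hypothesis shapes; nothing of Bałaban's asserted; no node discharged; one finite four-torus — NOT ℝ⁴ ∕
OS ∕ mass-gap ∕ Clay.  No decl below carries a cite tag.
-/

namespace Summit.QuantumFields.YangMills.Theorems.BalabanUVNodesN27SpineRecord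

open Literature.MathematicalPhysics.QuantumFieldTheory.Balaban1983to89
open Literature.MathematicalPhysics.QuantumFieldTheory.Balaban1983to89.T4Continuum

section NonDegenerate

variable {F : T4Family} {G : Type*} [GaugeGroup G] [MeasurableSpace G] [RegularGaugeGroup G] [HaarData G]

/-- The dressed partition functions of the datum's Wilson scheme are POSITIVE at every cutoff and source — the tree's scheme-level
`T4GenFunConverse.schemeZ_pos` BY NAME, its three hypotheses discharged at the datum: `β_K ≥ 0` (`scheme_β_eq`), measurable observables
(`measurable_avgObs` under `D.AvgMeasurable`), `1`-bounded observables (`abs_avgObs_le_one`). [folklore] -/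
theorem schemeZ_scheme_pos (D : FiniteEpsData F G) (hM : D.AvgMeasurable) (g₀ : ℕ → ℝ) (os : List (ULoop F)) (K : ℕ)
    (t : ℝ) : 0 < T4GenFunBounds.schemeZ (D.scheme g₀) os K t :=
  T4GenFunConverse.schemeZ_pos (D.scheme g₀) (fun K => (D.scheme_β_eq g₀ K).2) (fun K o => D.measurable_avgObs hM K o)
    (fun K o U => D.abs_avgObs_le_one K o U) K os t

/-- **A2-TYPE AUDIT IN KERNEL — run A's class totals are positive under E1.**  If run A's class sums are the genuine
`schemeZ (D.scheme g₀) os (K₀ + K) t` on `|t| ≤ l₀` (the E1 clause of the N27 join's `hK5`) and `D.AvgMeasurable`, then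
`0 < Σ_{τ ∈ T K} A K t τ` for every `K` and `|t| ≤ l₀`. [folklore] -/
theorem classTotal_pos_of_E1 (D : FiniteEpsData F G) (hM : D.AvgMeasurable) (g₀ : ℕ → ℝ) (os : List (ULoop F))
    {σ : Type*} {T : ℕ → Finset σ} {A : ℕ → ℝ → σ → ℝ} {l₀ : ℝ} {K₀ : ℕ}
    (hE1 : ∀ (K : ℕ) (t : ℝ), |t| ≤ l₀ →
      T4GenFunBounds.schemeZ (D.scheme g₀) os (K₀ + K) t = ∑ τ ∈ T K, A K t τ)
    (K : ℕ) {t : ℝ} (ht : |t| ≤ l₀) : 0 < ∑ τ ∈ T K, A K t τ := by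
  rw [← hE1 K t ht]
  exact schemeZ_scheme_pos D hM g₀ os (K₀ + K) t

/-- … and run B's under E2. [folklore] -/
theorem classTotalB_pos_of_E2 (D : FiniteEpsData F G) (hM : D.AvgMeasurable) (g₀ : ℕ → ℝ) (os : List (ULoop F))
    {σ : Type*} {T : ℕ → Finset σ} {B : ℕ → ℝ → σ → ℝ} {l₀ : ℝ} {K₀ : ℕ}
    (hE2 : ∀ (K : ℕ) (t : ℝ), |t| ≤ l₀ →
      T4GenFunBounds.schemeZ (D.scheme g₀) os (K₀ + K + 1) t = ∑ τ ∈ T K, B K t τ)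
    (K : ℕ) {t : ℝ} (ht : |t| ≤ l₀) : 0 < ∑ τ ∈ T K, B K t τ := by
  rw [← hE2 K t ht]
  exact schemeZ_scheme_pos D hM g₀ os (K₀ + K + 1) t

/-- **… hence every term class is NONEMPTY** (`0 ≤ l₀`; source `t = 0`): the E1 dictionary excludes the empty expansion at every cutoff.
[folklore] -/
theorem classes_nonempty_of_E1 (D : FiniteEpsData F G) (hM : D.AvgMeasurable) (g₀ : ℕ → ℝ) (os : List (ULoop F))
    {σ : Type*} {T : ℕ → Finset σ} {A : ℕ → ℝ → σ → ℝ} {l₀ : ℝ} {K₀ : ℕ} (hl₀ : 0 ≤ l₀)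
    (hE1 : ∀ (K : ℕ) (t : ℝ), |t| ≤ l₀ →
      T4GenFunBounds.schemeZ (D.scheme g₀) os (K₀ + K) t = ∑ τ ∈ T K, A K t τ)
    (K : ℕ) : (T K).Nonempty := by
  by_contra h
  rw [Finset.not_nonempty_iff_eq_empty] at h
  have h0 := classTotal_pos_of_E1 D hM g₀ os hE1 K (t := 0) (by simpa using hl₀)
  rw [h, Finset.sum_empty] at h0
  exact lt_irrefl _ h0

/-- **… and the good part is PROPER under N20**: with E1, `D.AvgMeasurable` and node N20's statement of record
`T4WeightBudget.RelWeightBound l₀ T A B Bad W` BY NAME (fields `bad_subset`, `bad_left`, `lt_one`: the bad class is a sub-class of relative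
weight `≤ W K < 1` in run A), the GOOD classes `T K ∖ Bad K t` carry POSITIVE total weight at every cutoff and `|t| ≤ l₀` (run B alike, from E2
and `bad_right`). [folklore] -/
theorem goodTotal_pos_of_E1 (D : FiniteEpsData F G) (hM : D.AvgMeasurable) (g₀ : ℕ → ℝ) (os : List (ULoop F))
    {σ : Type*} [DecidableEq σ] {T : ℕ → Finset σ} {Bad : ℕ → ℝ → Finset σ} {A B : ℕ → ℝ → σ → ℝ} {W : ℕ → ℝ}
    {l₀ : ℝ} {K₀ : ℕ}
    (hE1 : ∀ (K : ℕ) (t : ℝ), |t| ≤ l₀ →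
      T4GenFunBounds.schemeZ (D.scheme g₀) os (K₀ + K) t = ∑ τ ∈ T K, A K t τ)
    (h20 : T4WeightBudget.RelWeightBound l₀ T A B Bad W)
    (K : ℕ) {t : ℝ} (ht : |t| ≤ l₀) : 0 < ∑ τ ∈ T K \ Bad K t, A K t τ := by
  have htot := classTotal_pos_of_E1 D hM g₀ os hE1 K ht
  rw [Finset.sum_sdiff_eq_sub (h20.bad_subset K t ht)]
  have h1 := h20.bad_left K t ht
  have h2 : W K * ∑ τ ∈ T K, A K t τ < ∑ τ ∈ T K, A K t τ := by
    have := mul_lt_mul_of_pos_right (h20.lt_one K) htot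
    simpa using this
  linarith

end NonDegenerate

end Summit.QuantumFields.YangMills.Theorems.BalabanUVNodesN27SpineRecord
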